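import Summits.Ventures.Crystal3D.Theorems.StickyWulffConstantGenericWallFloorStackWalkDefs
import Summits.Ventures.Crystal3D.Theorems.StickyWulffConstantGenericWallFloorVacancyCage
import Summits.Ventures.Crystal3D.Theorems.StickyWulffConstantGenericWallFloorExactOnly
import HarnessLib

/-!
# The END-BALL SECOND CENTRE: a stopped walker sits next to an EMPTY exact site, which is ADDABLE (its touching balls are all
# short, census-free) or BLOCKED by an off-slot ball within `2` (crux `GenericWallFloor`, stmt-Ventures-19480, line `WallLedgerG`;
# cf-p1 (xlii″) 2026-08-28T22:08Z «k-residual = DEFECTIVE TWIN CAPS, vacancy-keyed row»; consumer: 19480-p1's `EndBallClass` interface)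

HONEST FRAMING. Venture `Summits/Ventures/Crystal3D` (cell `crystal3d-full`), helper `--supports` the crux `GenericWallFloor`
of `route-Ventures-StickyWulffConstant`, REGISTERED line `WallLedgerG`, open stub `stub_twoSlabAdhesion`.  Structure only,
census-free, standard axioms; F-C1 not moved; NOT the crux and no ledger.

WHAT A STOP MEANS (`…StackWalkDefs`: `walkStep`, `IsOrientedCap`; the author of the walk writes).  A walker at `y` with top entry
`(F, v)` STOPS iff `y` is not `F`-full AND is an oriented cap for NO normal.  Exact twin caps are therefore never end balls (they
PUSH/POP — «sealed», p644437/p646211), but DEFECTIVE caps are: a ball on a coherent twin/fault plane one of whose nine `F`-side cap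
sites or three mirror-capper sites is vacant stops every walker arriving along `v`, with up to three UNcertified contacts (the
mirror cappers) — 19480-p1 g11's «102 configurations residual in every frame» (deg `= k + 2`), beyond the reach of
`menu_or_payer_of_near_endBall` (`deg ≤ k + 1`).  The same objects seen from lane T: the `Σ9` junction dozens at a docking ball
(19480-p1's rhombus case) are the (β) NON-co-axial registered fcc pairs of the on-reach classes (`…TexShadowWeakZigSplit` /
`…OnReachSplit`), read from the end ball's side.
* `exists_empty_slot_of_walkStep_eq_none` — a stop has an EMPTY exact slot site `q = y + F w` (`dist y q = 1`);
* `capDefect_of_not_isOrientedCap` / `capDefect_of_walkStep_eq_none` — for every admissible arrival normal `n` (`⟪F v, n⟫ = √(2/3)`):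
  an empty `F`-side cap site, OR an occupied `F`-upper site, OR an EMPTY MIRROR-CAPPER site `y − F w + 2⟪F w, n⟫ n` (`dist = 1`);
* THE DICHOTOMY at an empty site `q` with `dist y q = 1` (`addable_or_blocked`): (A) `q` ADDABLE (every ball at distance `≥ 1` from
  `q`) ⇒ EVERY ball touching `q` — `y` itself and each occupied slot/capper ball adjacent to `q` — has `≤ 11` contacts
  (`touching_short_of_addable` = 19480-p1's `card_contacts_le_eleven_of_addable`, kissing number in `X ∪ {q}`; NOT «emptiness alone»:
  the credit is the addability), multiplicity `≤ 12` claimants per site (`card_touching_le_twelve`); (B) `q` BLOCKED by some `b ∈ X`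
  with `dist q b < 1` ⇒ `dist y b < 2` and `b` is NOT at any exact slot site of `y` (`blocker_not_slotSite`: slot sites are pairwise
  `≥ 1` apart) — an OFF-SLOT foreign ball within `2`, i.e. exactly the input of 19480-p1's `blocker_mem_blockerSites_or_payer` / payer
  branch, or a contradiction with `one_le_dist_of_cage(_sub_pair)` when the site's cage is registered.
* `endBall_second_centre` — the packaged statement at a stop.
WHAT THIS IS NOT: no claim that every `deg = k+2` end ball is a defective cap (with few certified slots the uncertified contacts are
unconstrained); which branch fires per class is 19480-p1's table; F-C1 not moved.
-/

noncomputable section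

namespace Summit.Ventures.Crystal3D.Theorems

open Summit.Ventures.Crystal3D Finset
open Literature.MathematicalPhysics.StatisticalMechanics (fccStacking isHaggSeq_const le_dist_of_mem_barlowStacking_ideal)
open scoped InnerProductSpace

variable {X : Finset (EuclideanSpace ℝ (Fin 3))}

/-! ### What a stop leaves next to the end ball -/

/-- **A stopped walker has an empty exact slot site.** -/
theorem exists_empty_slot_of_walkStep_eq_none {z y : EuclideanSpace ℝ (Fin 3)} {e : WalkEntry} {rest : List WalkEntry}
    (h : walkStep X z (y, e :: rest) = none) : ∃ w ∈ fccSlots, y + e.frame w ∉ X := by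
  have h1 := (not_full_not_cap_of_walkStep_eq_none X z y e rest h).1
  push Not at h1
  exact h1

/-- **Unfolding «not an oriented cap» for an admissible arrival normal**: an empty `F`-side cap site, or an occupied `F`-upper site,
or an empty mirror-capper site. -/
theorem capDefect_of_not_isOrientedCap {F : EuclideanSpace ℝ (Fin 3) ≃ₗᵢ[ℝ] EuclideanSpace ℝ (Fin 3)}
    {y v n : EuclideanSpace ℝ (Fin 3)} (hn : ‖n‖ = 1)
    (hmenu : ∀ w ∈ fccSlots, ⟪F w, n⟫_ℝ = 0 ∨ ⟪F w, n⟫_ℝ = Real.sqrt (2 / 3) ∨ ⟪F w, n⟫_ℝ = -Real.sqrt (2 / 3))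
    (hpos : ⟪F v, n⟫_ℝ = Real.sqrt (2 / 3)) (h : ¬ IsOrientedCap X F y v n) :
    (∃ w ∈ fccSlots, ⟪F w, n⟫_ℝ ≤ 0 ∧ y + F w ∉ X) ∨
      (∃ w ∈ fccSlots, 0 < ⟪F w, n⟫_ℝ ∧ y + F w ∈ X) ∨
      (∃ w ∈ fccSlots, 0 < ⟪F w, n⟫_ℝ ∧ y - F w + (2 * ⟪F w, n⟫_ℝ) • n ∉ X) := by
  by_contra hno
  push Not at hno
  obtain ⟨h1, h2, h3⟩ := hno
  exact h ⟨hn, hmenu, hpos, h1, fun w hw hp => ⟨h2 w hw hp, h3 w hw hp⟩⟩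

/-- **The cap defect at a stop**, for every admissible arrival normal of the top frame. -/
theorem capDefect_of_walkStep_eq_none {z y : EuclideanSpace ℝ (Fin 3)} {e : WalkEntry} {rest : List WalkEntry}
    (h : walkStep X z (y, e :: rest) = none) {n : EuclideanSpace ℝ (Fin 3)} (hn : ‖n‖ = 1)
    (hmenu : ∀ w ∈ fccSlots, ⟪e.frame w, n⟫_ℝ = 0 ∨ ⟪e.frame w, n⟫_ℝ = Real.sqrt (2 / 3) ∨ ⟪e.frame w, n⟫_ℝ = -Real.sqrt (2 / 3))
    (hpos : ⟪e.frame e.dir, n⟫_ℝ = Real.sqrt (2 / 3)) :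
    (∃ w ∈ fccSlots, ⟪e.frame w, n⟫_ℝ ≤ 0 ∧ y + e.frame w ∉ X) ∨
      (∃ w ∈ fccSlots, 0 < ⟪e.frame w, n⟫_ℝ ∧ y + e.frame w ∈ X) ∨
      (∃ w ∈ fccSlots, 0 < ⟪e.frame w, n⟫_ℝ ∧ y - e.frame w + (2 * ⟪e.frame w, n⟫_ℝ) • n ∉ X) := by
  have h2 := (not_full_not_cap_of_walkStep_eq_none X z y e rest h).2
  exact capDefect_of_not_isOrientedCap hn hmenu hpos fun hc => h2 ⟨n, hc⟩

/-! ### The sites at distance one -/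

/-- A slot site is at distance `1` from the ball. -/
theorem dist_slotSite_eq_one (F : EuclideanSpace ℝ (Fin 3) ≃ₗᵢ[ℝ] EuclideanSpace ℝ (Fin 3)) (y : EuclideanSpace ℝ (Fin 3))
    {w : EuclideanSpace ℝ (Fin 3)} (hw : w ∈ fccSlots) : dist y (y + F w) = 1 := by
  rw [dist_eq_norm, sub_add_cancel_left, norm_neg, LinearIsometryEquiv.norm_map, norm_eq_one_of_mem_fccSlots hw]

/-- A mirror-capper site is at distance `1` from the ball. -/
theorem dist_mirrorSite_eq_one (F : EuclideanSpace ℝ (Fin 3) ≃ₗᵢ[ℝ] EuclideanSpace ℝ (Fin 3)) (y : EuclideanSpace ℝ (Fin 3))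
    {w n : EuclideanSpace ℝ (Fin 3)} (hw : w ∈ fccSlots) (hn : ‖n‖ = 1) :
    dist y (y - F w + (2 * ⟪F w, n⟫_ℝ) • n) = 1 := by
  have hFw : ‖F w‖ = 1 := by rw [LinearIsometryEquiv.norm_map, norm_eq_one_of_mem_fccSlots hw]
  have hsq : ‖F w - (2 * ⟪F w, n⟫_ℝ) • n‖ ^ 2 = 1 := by
    rw [@norm_sub_sq_real, hFw, norm_smul, hn, mul_one, Real.norm_eq_abs, sq_abs, inner_smul_right]
    ring
  have hnn : 0 ≤ ‖F w - (2 * ⟪F w, n⟫_ℝ) • n‖ := norm_nonneg _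
  have h1 : ‖F w - (2 * ⟪F w, n⟫_ℝ) • n‖ = 1 := by nlinarith [hsq, hnn]
  rw [dist_eq_norm, show y - (y - F w + (2 * ⟪F w, n⟫_ℝ) • n) = F w - (2 * ⟪F w, n⟫_ℝ) • n by abel, h1]

/-- **Exact slot sites are pairwise `≥ 1` apart** (they are sites of the moved lattice). -/
theorem one_le_dist_slotSite_slotSite (F : EuclideanSpace ℝ (Fin 3) ≃ₗᵢ[ℝ] EuclideanSpace ℝ (Fin 3)) (y : EuclideanSpace ℝ (Fin 3))
    {w w' : EuclideanSpace ℝ (Fin 3)} (hw : w ∈ fccSlots) (hw' : w' ∈ fccSlots) (hne : w ≠ w') :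
    1 ≤ dist (y + F w) (y + F w') := by
  have h := le_dist_of_mem_barlowStacking_ideal isHaggSeq_const one_pos sqrt_twoThirds_sq
    (mem_fcc_of_mem_fccSlots hw) (mem_fcc_of_mem_fccSlots hw') hne
  rwa [dist_eq_norm, add_sub_add_left_eq_sub, ← map_sub, LinearIsometryEquiv.norm_map, ← dist_eq_norm]

/-! ### The dichotomy at an empty site: addable or blocked -/

/-- Every site is ADDABLE (all balls at distance `≥ 1`) or BLOCKED (some ball closer than `1`). -/
theorem addable_or_blocked (X : Finset (EuclideanSpace ℝ (Fin 3))) (q : EuclideanSpace ℝ (Fin 3)) :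
    (∀ b ∈ X, 1 ≤ dist q b) ∨ ∃ b ∈ X, dist q b < 1 := by
  by_cases h : ∀ b ∈ X, 1 ≤ dist q b
  · exact Or.inl h
  · push Not at h; exact Or.inr h

/-- **(A) An addable site makes every touching ball short** (19480-p1's `card_contacts_le_eleven_of_addable`: kissing number twelve in
`X ∪ {q}`; the credit comes from addability, not from emptiness). -/
theorem touching_short_of_addable (hX : ∀ p ∈ X, ∀ q ∈ X, p ≠ q → 1 ≤ dist p q) {q : EuclideanSpace ℝ (Fin 3)}
    (hq : ∀ b ∈ X, 1 ≤ dist q b) : ∀ b ∈ X, dist b q = 1 → (X.filter fun p => dist b p = 1).card ≤ 11 :=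
  fun _ _ hbq => card_contacts_le_eleven_of_addable X hX q hq hbq

/-- **Multiplicity**: at most twelve balls of a `1`-separated configuration touch a given site (kissing number). -/
theorem card_touching_le_twelve (hX : ∀ p ∈ X, ∀ q ∈ X, p ≠ q → 1 ≤ dist p q) (q : EuclideanSpace ℝ (Fin 3)) :
    (X.filter fun b => dist b q = 1).card ≤ 12 := by
  classical
  refine IsKissingAround.card_le_twelve (b := q) ⟨fun s hs => ?_, fun s hs t ht hst => ?_⟩
  · rw [dist_comm]; exact (mem_filter.1 hs).2
  · exact hX s (mem_filter.1 hs).1 t (mem_filter.1 ht).1 hst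

/-- **(B) A blocker of a site next to `y` is within `2` of `y`.** -/
theorem dist_lt_two_of_blocker {y q b : EuclideanSpace ℝ (Fin 3)} (hyq : dist y q = 1) (hb : dist q b < 1) : dist y b < 2 :=
  calc dist y b ≤ dist y q + dist q b := dist_triangle _ _ _
    _ < 1 + 1 := by linarith
    _ = 2 := by norm_num

/-- **(B) A blocker of an EMPTY SLOT site of `y` occupies no slot site of `y`** (the slot sites are pairwise `≥ 1` apart and the blocked
one is empty). -/
theorem blocker_not_slotSite (F : EuclideanSpace ℝ (Fin 3) ≃ₗᵢ[ℝ] EuclideanSpace ℝ (Fin 3)) {y b : EuclideanSpace ℝ (Fin 3)}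
    {w : EuclideanSpace ℝ (Fin 3)} (hw : w ∈ fccSlots) (hq : y + F w ∉ X) (hbX : b ∈ X) (hb : dist (y + F w) b < 1) :
    ∀ w' ∈ fccSlots, b ≠ y + F w' := by
  intro w' hw' hbw'
  by_cases hww : w = w'
  · exact hq (by rw [hww, ← hbw']; exact hbX)
  · have h1 := one_le_dist_slotSite_slotSite F y hw hw' hww
    rw [← hbw'] at h1
    linarith

/-- A blocker keeps distance `≥ 1` from nothing it blocks: it is none of the balls known to be at distance `≥ 1` from the site. -/
theorem blocker_ne_of_le_dist {q b p : EuclideanSpace ℝ (Fin 3)} (hp : 1 ≤ dist q p) (hb : dist q b < 1) : b ≠ p :=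
  fun h => by rw [h] at hb; linarith

/-! ### The packaged statement at a stop -/

/-- **THE END-BALL SECOND CENTRE.**  At a stopped walker `(y, (F, v, ·) :: rest)` in a `1`-separated `X` there is an EMPTY exact slot
site `q = y + F w` at distance `1` from `y`, and EITHER (A) `q` is addable — then every ball touching `q` (among them `y` and every
occupied slot ball of `y` adjacent to `q`) has at most eleven contacts, and at most twelve balls touch `q` — OR (B) `q` is blocked by
a ball `b ∈ X` within `2` of `y` that sits at NO exact slot site of `y` (an off-slot foreign ball: 19480-p1's blocker/payer input). -/
theorem endBall_second_centre (hX : ∀ p ∈ X, ∀ q ∈ X, p ≠ q → 1 ≤ dist p q)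
    {z y : EuclideanSpace ℝ (Fin 3)} {e : WalkEntry} {rest : List WalkEntry} (h : walkStep X z (y, e :: rest) = none) :
    ∃ w ∈ fccSlots, y + e.frame w ∉ X ∧ dist y (y + e.frame w) = 1 ∧
      (((∀ b ∈ X, 1 ≤ dist (y + e.frame w) b) ∧
          (∀ b ∈ X, dist b (y + e.frame w) = 1 → (X.filter fun p => dist b p = 1).card ≤ 11) ∧
          (X.filter fun b => dist b (y + e.frame w) = 1).card ≤ 12) ∨
        (∃ b ∈ X, dist (y + e.frame w) b < 1 ∧ dist y b < 2 ∧ ∀ w' ∈ fccSlots, b ≠ y + e.frame w')) := by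
  obtain ⟨w, hw, hq⟩ := exists_empty_slot_of_walkStep_eq_none h
  have hd := dist_slotSite_eq_one e.frame y hw
  refine ⟨w, hw, hq, hd, ?_⟩
  rcases addable_or_blocked X (y + e.frame w) with hA | ⟨b, hbX, hb⟩
  · exact Or.inl ⟨hA, touching_short_of_addable hX hA, card_touching_le_twelve hX _⟩
  · exact Or.inr ⟨b, hbX, hb, dist_lt_two_of_blocker hd hb, blocker_not_slotSite e.frame hw hq hbX hb⟩

/-- **The same dichotomy at an empty MIRROR-CAPPER site** (the defective-cap reading: the missing capper's site is the second
centre; its blocker, if any, is within `2` of `y`). -/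
theorem mirrorSite_second_centre (hX : ∀ p ∈ X, ∀ q ∈ X, p ≠ q → 1 ≤ dist p q)
    (F : EuclideanSpace ℝ (Fin 3) ≃ₗᵢ[ℝ] EuclideanSpace ℝ (Fin 3)) (y : EuclideanSpace ℝ (Fin 3))
    {w n : EuclideanSpace ℝ (Fin 3)} (hw : w ∈ fccSlots) (hn : ‖n‖ = 1) :
    dist y (y - F w + (2 * ⟪F w, n⟫_ℝ) • n) = 1 ∧
      (((∀ b ∈ X, 1 ≤ dist (y - F w + (2 * ⟪F w, n⟫_ℝ) • n) b) ∧
          (∀ b ∈ X, dist b (y - F w + (2 * ⟪F w, n⟫_ℝ) • n) = 1 → (X.filter fun p => dist b p = 1).card ≤ 11) ∧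
          (X.filter fun b => dist b (y - F w + (2 * ⟪F w, n⟫_ℝ) • n) = 1).card ≤ 12) ∨
        (∃ b ∈ X, dist (y - F w + (2 * ⟪F w, n⟫_ℝ) • n) b < 1 ∧ dist y b < 2)) := by
  have hd := dist_mirrorSite_eq_one F y hw hn
  refine ⟨hd, ?_⟩
  rcases addable_or_blocked X (y - F w + (2 * ⟪F w, n⟫_ℝ) • n) with hA | ⟨b, hbX, hb⟩
  · exact Or.inl ⟨hA, touching_short_of_addable hX hA, card_touching_le_twelve hX _⟩
  · exact Or.inr ⟨b, hbX, hb, dist_lt_two_of_blocker hd hb⟩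

end Summit.Ventures.Crystal3D.Theorems

end
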